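import Summits.AtomisticToContinuum.Crystallization.Theorems.FrustratedLawDichotomyTwistedDozen
import Literature.Geometry.DiscreteGeometry.BondGraph

/-!
# FrustratedLawDichotomy · crux `AperiodicFrustratedLawGap` (stmt-AtomisticToContinuum-27623) — `KR` («kissing rigidity at 1/100»:
# a charge-free(1/100) site is robustly good) IS FALSE: the twisted dozen with its centre (decomp-a2c, prover hand 2, gen 8)

`KR` is the hypothesis `hKR` of `FrustratedLawDichotomyChargedGapRigidityDoor.frustrationDensityGap_of_chargedEnergyGap` (the concordance
edge `ChargedEnergyGap (14231) ∧ KR ⟹ FDG`, p816068; census line I-RIG′): in every finite injective `7/10`-separated configuration `y`, a site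
that is charge-free at tolerance `1/100` (`Literature…IsChargeFree`: twelve bonds in the scale-free bond graph, every bond of ring number `4`)
is robustly good (an fcc/hcp shell within `η·d`, `η < 1/20`, of its nearest-neighbour scale `d`, clean `13/10·d`-gap).

**It is false.**  Witness: the `13`-atom cluster `y` = centre `0` + the twisted dozen `(0,±5,±6), (±6,0,±5), (±5,±6,0)` of
`FrustratedLawDichotomyTwistedDozen` (integer coordinates; minimum distance `√61 > 7/10`).  Every site has nearest-neighbour distance `√61`
(centre–shell), so the `1/100`-bond graph bonds exactly the pairs at distance `≤ 1.01·√61`, i.e. at squared distance `≤ 62`: the centre is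
bonded to all twelve shell atoms, each shell atom to the centre and to its four jitterbug contacts (squared length `62 ≤ 62.2261`), nothing
else (next squared distance `100`).  Hence the centre is charge-free(1/100) — twelve bonds, every ring number `4` — while (by the `√2`-pair
obstruction of the companion file: no squared shell distance lies strictly between `100` and `144`) its shell is NOT within `η·√61`, `η < 1/20`,
of any rotated fcc/hcp pattern; the nearest-neighbour clauses of robust goodness force `d = √61`.

Consequence: the hypothesis `KR` of p816068 (and, via `kr_of_krShape` / `kr_of_krShape12`, the statements `KR_shape`, `KR_shape12`) is
refuted; `IsChargeFree (1/100)` does not certify `1/20`-goodness (the jitterbug flex moves contacts to second order only).  The concordance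
`14231 ⟹ FDG` needs a charge notion with bond tolerance `≲ 1/400` or angular/second-shell data.

* `not_kr` : `¬ KR`, the text of `hKR` VERBATIM, negated.  `[folklore]`; no definitions, no `sorry`; integer facts by `decide`.
-/

noncomputable section

namespace Summit.AtomisticToContinuum.Crystallization.Theorems.FrustratedLawDichotomyTwistedDozenChargeFree

open Literature.Geometry.DiscreteGeometry
open Summit.AtomisticToContinuum.Crystallization.Theorems.FrustratedLawDichotomyTwistedDozen (fit_pair_bound twisted_dozen_no_sqrt_two)

/-- **`KR` is false** (hypothesis `hKR` of `FrustratedLawDichotomyChargedGapRigidityDoor.frustrationDensityGap_of_chargedEnergyGap`, verbatim,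
negated): the centre of the twisted dozen is a charge-free(1/100) site of a `7/10`-separated `13`-atom configuration that is not robustly good.
[folklore] -/
theorem not_kr :
    ¬ (∀ (N : ℕ) (y : Fin N → EuclideanSpace ℝ (Fin 3)), Function.Injective y → (∀ a b : Fin N, a ≠ b → (7 : ℝ) / 10 ≤ dist (y a) (y b)) → ∀ i : Fin N, Literature.Geometry.DiscreteGeometry.IsChargeFree (1 / 100 : ℝ) y i → ∃ (d η γ : ℝ) (A : EuclideanSpace ℝ (Fin 3) →ₗᵢ[ℝ] EuclideanSpace ℝ (Fin 3)), (∃ t : ↥Literature.Geometry.DiscreteGeometry.fccKissingPattern → EuclideanSpace ℝ (Fin 3), 0 < d ∧ 0 < γ ∧ η < 1 / 20 ∧ (∀ u : ↥Literature.Geometry.DiscreteGeometry.fccKissingPattern, t u ∈ (Set.range y) ∧ ‖(t u - (y i)) - d • A (u : EuclideanSpace ℝ (Fin 3))‖ ≤ η * d) ∧ (∀ s : EuclideanSpace ℝ (Fin 3), s ∈ (Set.range y) → s ≠ (y i) → d ≤ dist s (y i)) ∧ (∃ s : EuclideanSpace ℝ (Fin 3), s ∈ (Set.range y) ∧ s ≠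 (y i) ∧ dist s (y i) ≤ d) ∧ (∀ s : EuclideanSpace ℝ (Fin 3), s ∈ (Set.range y) → s ≠ (y i) → dist s (y i) < 13 / 10 * d + γ → dist s (y i) ≤ 13 / 10 * d - γ ∧ s ∈ Set.range t)) ∨ (∃ t : ↥Literature.Geometry.DiscreteGeometry.hcpKissingPattern → EuclideanSpace ℝ (Fin 3), 0 < d ∧ 0 < γ ∧ η < 1 / 20 ∧ (∀ u : ↥Literature.Geometry.DiscreteGeometry.hcpKissingPattern, t u ∈ (Set.range y) ∧ ‖(t u - (y i)) - d • A (u : EuclideanSpace ℝ (Fin 3))‖ ≤ η * d) ∧ (∀ s : EuclideanSpace ℝ (Fin 3), s ∈ (Set.range y) → s ≠ (y i) → d ≤ dist s (y i)) ∧ (∃ s : EuclideanSpace ℝ (Fin 3), s ∈ (Set.range y) ∧ s ≠ (y i) ∧ dist s (y i) ≤ d) ∧ (∀ s : EuclideanSpace ℝ (Fin 3), s ∈ (Set.range y) → s ≠ (y i) → dist s (y i) < 13 / 10 * d + γ → dist s (y i) ≤ 13 / 10 * d - γ ∧ s ∈ Set.range t))) := by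
  intro h
  -- integer facts of the 13-atom cluster (centre = index 0), by `decide`
  have G1 : ∀ a b : Fin 13, a ≠ b → 61 ≤ sqNormInt ((![![0, 0, 0], ![0, 5, 6], ![0, 5, -6], ![0, -5, 6], ![0, -5, -6], ![6, 0, 5], ![6, 0, -5], ![-6, 0, 5], ![-6, 0, -5], ![5, 6, 0], ![5, -6, 0], ![-5, 6, 0], ![-5, -6, 0]] : Fin 13 → Fin 3 → ℤ) a - (![![0, 0, 0], ![0, 5, 6], ![0, 5, -6], ![0, -5, 6], ![0, -5, -6], ![6, 0, 5], ![6, 0, -5], ![-6, 0, 5], ![-6, 0, -5], ![5, 6, 0], ![5, -6, 0], ![-5, 6, 0], ![-5, -6, 0]] : Fin 13 → Fin 3 → ℤ) b) := by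
    decide
  have G2 : ∀ a : Fin 13, a ≠ 0 → sqNormInt ((![![0, 0, 0], ![0, 5, 6], ![0, 5, -6], ![0, -5, 6], ![0, -5, -6], ![6, 0, 5], ![6, 0, -5], ![-6, 0, 5], ![-6, 0, -5], ![5, 6, 0], ![5, -6, 0], ![-5, 6, 0], ![-5, -6, 0]] : Fin 13 → Fin 3 → ℤ) a - (![![0, 0, 0], ![0, 5, 6], ![0, 5, -6], ![0, -5, 6], ![0, -5, -6], ![6, 0, 5], ![6, 0, -5], ![-6, 0, 5], ![-6, 0, -5], ![5, 6, 0], ![5, -6, 0], ![-5, 6, 0], ![-5, -6, 0]] : Fin 13 → Fin 3 → ℤ) 0) = 61 := by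
    decide
  have G2' : sqNormInt ((![![0, 0, 0], ![0, 5, 6], ![0, 5, -6], ![0, -5, 6], ![0, -5, -6], ![6, 0, 5], ![6, 0, -5], ![-6, 0, 5], ![-6, 0, -5], ![5, 6, 0], ![5, -6, 0], ![-5, 6, 0], ![-5, -6, 0]] : Fin 13 → Fin 3 → ℤ) 0 - (![![0, 0, 0], ![0, 5, 6], ![0, 5, -6], ![0, -5, 6], ![0, -5, -6], ![6, 0, 5], ![6, 0, -5], ![-6, 0, 5], ![-6, 0, -5], ![5, 6, 0], ![5, -6, 0], ![-5, 6, 0], ![-5, -6, 0]] : Fin 13 → Fin 3 → ℤ) 1) = 61 := by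
    decide
  have G3 : ∀ a b : Fin 13, a ≠ b → sqNormInt ((![![0, 0, 0], ![0, 5, 6], ![0, 5, -6], ![0, -5, 6], ![0, -5, -6], ![6, 0, 5], ![6, 0, -5], ![-6, 0, 5], ![-6, 0, -5], ![5, 6, 0], ![5, -6, 0], ![-5, 6, 0], ![-5, -6, 0]] : Fin 13 → Fin 3 → ℤ) a - (![![0, 0, 0], ![0, 5, 6], ![0, 5, -6], ![0, -5, 6], ![0, -5, -6], ![6, 0, 5], ![6, 0, -5], ![-6, 0, 5], ![-6, 0, -5], ![5, 6, 0], ![5, -6, 0], ![-5, 6, 0], ![-5, -6, 0]] : Fin 13 → Fin 3 → ℤ) b) ≤ 62 ∨ 100 ≤ sqNormInt ((![![0, 0, 0], ![0, 5, 6], ![0, 5, -6], ![0, -5, 6], ![0, -5, -6], ![6, 0, 5], ![6, 0, -5], ![-6, 0, 5], ![-6, 0, -5], ![5, 6, 0], ![5, -6, 0], ![-5, 6, 0], ![-5, -6, 0]] : Fin 13 → Fin 3 → ℤ) a - (![![0, 0, 0], ![0, 5, 6], ![0, 5, -6], ![0, -5, 6], ![0, -5, -6], ![6, 0, 5], ![6,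 0, -5], ![-6, 0, 5], ![-6, 0, -5], ![5, 6, 0], ![5, -6, 0], ![-5, 6, 0], ![-5, -6, 0]] : Fin 13 → Fin 3 → ℤ) b) := by
    decide
  have G5 : ∀ j : Fin 13, j ≠ 0 → (Finset.univ.filter fun k : Fin 13 => ((0 : Fin 13) ≠ k ∧ sqNormInt ((![![0, 0, 0], ![0, 5, 6], ![0, 5, -6], ![0, -5, 6], ![0, -5, -6], ![6, 0, 5], ![6, 0, -5], ![-6, 0, 5], ![-6, 0, -5], ![5, 6, 0], ![5, -6, 0], ![-5, 6, 0], ![-5, -6, 0]] : Fin 13 → Fin 3 → ℤ) 0 - (![![0, 0, 0], ![0, 5, 6], ![0, 5, -6], ![0, -5, 6], ![0, -5, -6], ![6, 0, 5], ![6, 0, -5], ![-6, 0, 5], ![-6, 0, -5], ![5, 6, 0], ![5, -6, 0], ![-5, 6, 0], ![-5, -6, 0]] : Fin 13 → Fin 3 → ℤ) k) ≤ 62) ∧ (j ≠ k ∧ sqNormInt ((![![0, 0, 0], ![0, 5, 6], ![0, 5, -6], ![0, -5, 6], ![0, -5, -6], ![6, 0, 5], ![6, 0, -5], ![-6, 0,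 5], ![-6, 0, -5], ![5, 6, 0], ![5, -6, 0], ![-5, 6, 0], ![-5, -6, 0]] : Fin 13 → Fin 3 → ℤ) j - (![![0, 0, 0], ![0, 5, 6], ![0, 5, -6], ![0, -5, 6], ![0, -5, -6], ![6, 0, 5], ![6, 0, -5], ![-6, 0, 5], ![-6, 0, -5], ![5, 6, 0], ![5, -6, 0], ![-5, 6, 0], ![-5, -6, 0]] : Fin 13 → Fin 3 → ℤ) k) ≤ 62)).card = 4 := by
    decide
  have G6 : ∀ a b : Fin 13, sqNormInt ((![![0, 0, 0], ![0, 5, 6], ![0, 5, -6], ![0, -5, 6], ![0, -5, -6], ![6, 0, 5], ![6, 0, -5], ![-6, 0, 5], ![-6, 0, -5], ![5, 6, 0], ![5, -6, 0], ![-5, 6, 0], ![-5, -6, 0]] : Fin 13 → Fin 3 → ℤ) a - (![![0, 0, 0], ![0, 5, 6], ![0, 5, -6], ![0, -5, 6], ![0, -5, -6], ![6, 0, 5], ![6, 0, -5], ![-6, 0, 5], ![-6, 0, -5], ![5, 6, 0], ![5, -6, 0], ![-5, 6, 0], ![-5, -6, 0]] : Fin 13 → Fin 3 → ℤ) b) ≤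 100 ∨ 144 ≤ sqNormInt ((![![0, 0, 0], ![0, 5, 6], ![0, 5, -6], ![0, -5, 6], ![0, -5, -6], ![6, 0, 5], ![6, 0, -5], ![-6, 0, 5], ![-6, 0, -5], ![5, 6, 0], ![5, -6, 0], ![-5, 6, 0], ![-5, -6, 0]] : Fin 13 → Fin 3 → ℤ) a - (![![0, 0, 0], ![0, 5, 6], ![0, 5, -6], ![0, -5, 6], ![0, -5, -6], ![6, 0, 5], ![6, 0, -5], ![-6, 0, 5], ![-6, 0, -5], ![5, 6, 0], ![5, -6, 0], ![-5, 6, 0], ![-5, -6, 0]] : Fin 13 → Fin 3 → ℤ) b) := by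
    decide
  have G7 : (Finset.univ.filter fun k : Fin 13 => (0 : Fin 13) ≠ k ∧ sqNormInt ((![![0, 0, 0], ![0, 5, 6], ![0, 5, -6], ![0, -5, 6], ![0, -5, -6], ![6, 0, 5], ![6, 0, -5], ![-6, 0, 5], ![-6, 0, -5], ![5, 6, 0], ![5, -6, 0], ![-5, 6, 0], ![-5, -6, 0]] : Fin 13 → Fin 3 → ℤ) 0 - (![![0, 0, 0], ![0, 5, 6], ![0, 5, -6], ![0, -5, 6], ![0, -5, -6], ![6, 0, 5], ![6, 0, -5], ![-6, 0, 5], ![-6, 0, -5], ![5, 6, 0], ![5, -6, 0], ![-5, 6, 0], ![-5, -6, 0]] : Fin 13 → Fin 3 → ℤ) k) ≤ 62).card = 12 := by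
    decide
  -- the cluster in `ℝ³`
  set W : Fin 13 → Fin 3 → ℤ := ![![0, 0, 0], ![0, 5, 6], ![0, 5, -6], ![0, -5, 6], ![0, -5, -6], ![6, 0, 5], ![6, 0, -5], ![-6, 0, 5], ![-6, 0, -5], ![5, 6, 0], ![5, -6, 0], ![-5, 6, 0], ![-5, -6, 0]] with hW
  set y : Fin 13 → EuclideanSpace ℝ (Fin 3) := fun a => intVec (W a) with hy
  have hdist : ∀ a b : Fin 13, dist (y a) (y b) = Real.sqrt (sqNormInt (W a - W b) : ℝ) := by
    intro a b; rw [dist_eq_norm, hy]; simp only; rw [intVec_sub, norm_intVec]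
  have h61lt : Real.sqrt 61 < 8 := by
    rw [show (8 : ℝ) = Real.sqrt (8 ^ 2) by rw [Real.sqrt_sq (by norm_num)]]
    exact Real.sqrt_lt_sqrt (by norm_num) (by norm_num)
  have h61pos : 0 < Real.sqrt 61 := by positivity
  -- injective and `7/10`-separated
  have hinj : Function.Injective y := by
    intro a b hab
    by_contra hne
    have h0 : dist (y a) (y b) = 0 := by rw [hab, dist_self]
    rw [hdist] at h0
    have h61 : (61 : ℝ) ≤ sqNormInt (W a - W b) := by exact_mod_cast G1 a b hne
    have := Real.sqrt_eq_zero'.1 h0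
    linarith
  have hsep : ∀ a b : Fin 13, a ≠ b → (7 : ℝ) / 10 ≤ dist (y a) (y b) := by
    intro a b hab
    rw [hdist]
    have h61 : (61 : ℝ) ≤ sqNormInt (W a - W b) := by exact_mod_cast G1 a b hab
    have h7 : (7 : ℝ) / 10 ≤ Real.sqrt 61 := by
      rw [show (7 : ℝ) / 10 = Real.sqrt ((7 / 10) ^ 2) by rw [Real.sqrt_sq (by norm_num)]]
      exact Real.sqrt_le_sqrt (by norm_num)
    exact h7.trans (Real.sqrt_le_sqrt h61)
  -- every nearest-neighbour distance is `√61`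
  have hnn : ∀ a : Fin 13, nearestDist y a = Real.sqrt 61 := by
    intro a
    refine le_antisymm ?_ (le_nearestDist ⟨if a = 0 then 1 else 0, by
      split_ifs with h0
      · subst h0; decide
      · exact fun h' => h0 h'.symm⟩ fun k hk => ?_)
    · by_cases ha : a = 0
      · subst ha
        have h := nearestDist_le_dist y (j := (0 : Fin 13)) (k := 1) (by decide)
        rwa [hdist, show (sqNormInt (W 0 - W 1) : ℝ) = 61 by exact_mod_cast G2'] at h
      · have h := nearestDist_le_dist y (j := a) (k := 0) (fun h0 => ha h0.symm)
        rwa [hdist, show (sqNormInt (W a - W 0) : ℝ) = 61 by exact_mod_cast G2 a ha] at h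
    · rw [hdist]
      exact Real.sqrt_le_sqrt (by exact_mod_cast G1 a k (fun h' => hk h'.symm))
  -- the `1/100`-bond graph: bonded iff squared distance `≤ 62`
  have hadj : ∀ a b : Fin 13, (bondGraph (1 / 100 : ℝ) y).Adj a b ↔ a ≠ b ∧ sqNormInt (W a - W b) ≤ 62 := by
    intro a b
    rw [bondGraph_adj, hnn, hnn, min_self, hdist]
    refine ⟨fun ⟨hab, hle⟩ => ⟨hab, ?_⟩, fun ⟨hab, hle⟩ => ⟨hab, ?_⟩⟩
    · rcases G3 a b hab with h62 | h100
      · exact h62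
      · exfalso
        have h10 : (10 : ℝ) ≤ Real.sqrt (sqNormInt (W a - W b) : ℝ) :=
          Real.le_sqrt_of_sq_le (by exact_mod_cast (show (10 : ℤ) ^ 2 ≤ _ by linarith))
        linarith
    · have h62 : (sqNormInt (W a - W b) : ℝ) ≤ 62 := by exact_mod_cast hle
      calc Real.sqrt (sqNormInt (W a - W b) : ℝ) ≤ Real.sqrt 62 := Real.sqrt_le_sqrt h62
        _ ≤ Real.sqrt ((1 + 1 / 100) ^ 2 * 61) := Real.sqrt_le_sqrt (by norm_num)
        _ = (1 + 1 / 100) * Real.sqrt 61 := by rw [Real.sqrt_mul (by positivity), Real.sqrt_sq (by positivity)]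
  -- the centre is charge-free at tolerance `1/100`
  have hN0 : (bondGraph (1 / 100 : ℝ) y).neighborSet 0 =
      ↑(Finset.univ.filter fun k : Fin 13 => (0 : Fin 13) ≠ k ∧ sqNormInt (W 0 - W k) ≤ 62) := by
    ext k
    simp only [SimpleGraph.mem_neighborSet, Finset.coe_filter, Finset.mem_univ, true_and, Set.mem_setOf_eq, hadj]
  have hcf : IsChargeFree (1 / 100 : ℝ) y 0 := by
    refine ⟨by rw [hN0, Set.ncard_coe_finset, G7], fun j hj => ?_⟩
    have hj0 : j ≠ 0 := by
      rw [SimpleGraph.mem_neighborSet, hadj] at hj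
      exact fun h' => hj.1 h'.symm
    have hNj : (bondGraph (1 / 100 : ℝ) y).neighborSet 0 ∩ (bondGraph (1 / 100 : ℝ) y).neighborSet j =
        ↑(Finset.univ.filter fun k : Fin 13 =>
          ((0 : Fin 13) ≠ k ∧ sqNormInt (W 0 - W k) ≤ 62) ∧ (j ≠ k ∧ sqNormInt (W j - W k) ≤ 62)) := by
      ext k
      simp only [Set.mem_inter_iff, SimpleGraph.mem_neighborSet, Finset.coe_filter, Finset.mem_univ, true_and,
        Set.mem_setOf_eq, hadj]
    rw [ringNumber_def, hNj, Set.ncard_coe_finset, G5 j hj0]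
  -- feed the witness to `KR`
  obtain ⟨d, η, γ, A, hfit⟩ := h 13 y hinj hsep 0 hcf
  -- the nearest-neighbour clauses pin the scale: `d = √61`
  have hscale : ∀ {d : ℝ}, (∀ s : EuclideanSpace ℝ (Fin 3), s ∈ Set.range y → s ≠ y 0 → d ≤ dist s (y 0)) →
      (∃ s : EuclideanSpace ℝ (Fin 3), s ∈ Set.range y ∧ s ≠ y 0 ∧ dist s (y 0) ≤ d) → d = Real.sqrt 61 := by
    rintro d hle ⟨s, ⟨b, rfl⟩, hb0, hbd⟩
    have hb : b ≠ 0 := fun hb => hb0 (by rw [hb])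
    have h1 : y 1 ≠ y 0 := fun h' => absurd (hinj h') (by decide)
    have hup := hle (y 1) ⟨1, rfl⟩ h1
    rw [hdist, show (sqNormInt (W 1 - W 0) : ℝ) = 61 by exact_mod_cast G2 1 (by decide)] at hup
    rw [hdist, show (sqNormInt (W b - W 0) : ℝ) = 61 by exact_mod_cast G2 b hb] at hbd
    exact le_antisymm hup hbd
  -- a `√2`-pair of a scaled integer pattern kills any fit at scale `√61`
  have key : ∀ (S : Finset (Fin 3 → ℤ)) (N : ℕ) (hN : N ≠ 0) (v w : Fin 3 → ℤ) (hv : v ∈ S) (hw : w ∈ S) (hvw : v ≠ w)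
      (hsq : (sqNormInt (v - w) : ℝ) = 2 * N) (t : ↥(scaledPattern S N) → EuclideanSpace ℝ (Fin 3)), η < 1 / 20 →
      (∀ u : ↥(scaledPattern S N), t u ∈ Set.range y ∧ ‖(t u - y 0) - Real.sqrt 61 • A (u : EuclideanSpace ℝ (Fin 3))‖ ≤ η * Real.sqrt 61) →
      False := by
    intro S N hN v w hv hw hvw hsq t hη ht
    have hmv : (Real.sqrt N)⁻¹ • intVec v ∈ scaledPattern S N := Finset.mem_image_of_mem _ hv
    have hmw : (Real.sqrt N)⁻¹ • intVec w ∈ scaledPattern S N := Finset.mem_image_of_mem _ hw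
    set u0 : ↥(scaledPattern S N) := ⟨_, hmv⟩ with hu0
    set v0 : ↥(scaledPattern S N) := ⟨_, hmw⟩ with hv0
    have hNpos : (0 : ℝ) < Real.sqrt N := by positivity
    have hs : ‖(u0 : EuclideanSpace ℝ (Fin 3)) - (v0 : EuclideanSpace ℝ (Fin 3))‖ ^ 2 = 2 := by
      simp only [hu0, hv0]
      rw [← smul_sub, intVec_sub, norm_smul, norm_inv, Real.norm_of_nonneg hNpos.le, norm_intVec, mul_pow, inv_pow,
        Real.sq_sqrt (by positivity), Real.sq_sqrt (by linarith [show (0 : ℝ) ≤ 2 * N by positivity]), hsq]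
      field_simp
    obtain ⟨a, ha⟩ := (ht u0).1
    obtain ⟨b, hb⟩ := (ht v0).1
    obtain ⟨hlo, hhi⟩ := fit_pair_bound h61pos.le A (ht u0).2 (ht v0).2
    have hD : ‖(t u0 - y 0) - (t v0 - y 0)‖ = Real.sqrt (sqNormInt (W a - W b) : ℝ) := by
      rw [show (t u0 - y 0) - (t v0 - y 0) = t u0 - t v0 by abel, ← ha, ← hb, ← dist_eq_norm, hdist]
    rw [hD] at hlo hhi
    have hr : η * Real.sqrt 61 < Real.sqrt 61 / 20 := by nlinarith
    exact twisted_dozen_no_sqrt_two rfl (G6 a b) hs (norm_nonneg _) hr hlo hhi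
  have h4 : sqNormInt ((![1, 1, 0] : Fin 3 → ℤ) - ![-1, 1, 0]) = 4 := by decide
  have h36 : sqNormInt ((![3, 3, 0] : Fin 3 → ℤ) - ![-3, 3, 0]) = 36 := by decide
  rcases hfit with ⟨t, hd0, hγ, hη, hfitu, hle, hex, -⟩ | ⟨t, hd0, hγ, hη, hfitu, hle, hex, -⟩
  · have hd := hscale hle hex
    subst hd
    exact key fccInt 2 two_ne_zero ![1, 1, 0] ![-1, 1, 0] (by decide) (by decide) (by decide) (by rw [h4]; norm_num) t hη hfitu
  · have hd := hscale hle hex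
    subst hd
    exact key hcpInt 18 (by norm_num) ![3, 3, 0] ![-3, 3, 0] (by decide) (by decide) (by decide) (by rw [h36]; norm_num) t hη hfitu

end Summit.AtomisticToContinuum.Crystallization.Theorems.FrustratedLawDichotomyTwistedDozenChargeFree

end
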